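import Mathlib
import Summits.PneNP.PneNP.Theorems.ConvexRankGatesConvexGateBlindExactLiftingTriangleHoeffding

/-!
# PneNP / ConvexRankGates — `ConvexGateBlind`, line `xor-door-perfect-completeness`:
# LEMMA Ψ, levels one and two — colour-class masses on one and two blocks (prover seat 0, session 21)

Helper toward crux item stmt-PneNP-10680 (`--supports`; open stub `stub_exactLifting`; triangle instance of record).
Memo ANALYSIS11, Step 2, the two lower levels of the peeling:

* `oneD_card_le`: for non-negative weights `k` on one block (mass `Σk > 0`, peak `≤ kmax`), a margin `c > 0` and a
  colour `β`, `#{x¹ : (1/2 + c)Σk < Σ_{a : x¹_a = β} k_a} ≤ 2^t e^{−2c²Σk/kmax}` (counting Hoeffding);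
* `twoD_card_le` (registered sub-goal `twoD_count_bound`): for non-negative weights `pl` on two blocks (mass `P > 0`,
  peak `≤ kmax`), `c, η' > 0` and a colour `β`,
  `#{(x¹,x²) : (1/2 + c)P < pl(C¹_β × C²_β)} ≤ 4^t e^{−9c²/(8η')} + (2^t/η')·2^t e^{−2(c/4)² η' P/kmax}`:
  columns of relative mass `≥ η'` are HEAVY (at most `1/η'` of them); given `x¹`, the peeling lemma `peel_card_le`
  bounds the colourings `x²` unless a heavy column is exceptional, which is the 1D event.
Generic counting helpers (`card_filter_prod_eq`, `sum_card_le_split`, `card_heavy_le`, `mul_exp_neg_le`).  Elementary;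
no definitions.
-/

set_option linter.dupNamespace false -- `Summit.PneNP.PneNP.…`: summit = sub-problem (D-0017)

namespace Summit.PneNP.PneNP.Theorems.XorDoor.TriLine

open scoped BigOperators
open Finset Real

noncomputable section

variable {t : ℕ}

/-! ## §1 Generic counting -/

/-- Counting over a product, first coordinate first. -/
lemma card_filter_prod_eq {α β : Type*} [Fintype α] [Fintype β] (P : α × β → Prop) [DecidablePred P] :
    #(univ.filter P) = ∑ a, #(univ.filter fun b => P (a, b)) := by
  rw [card_filter, Fintype.sum_prod_type]
  exact sum_congr rfl fun a _ => by rw [card_filter]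

/-- Splitting a sum of fibre counts into good and bad base points. -/
lemma sum_card_le_split {α β : Type*} [Fintype α] [Fintype β] (P : α → β → Prop) [∀ a, DecidablePred (P a)]
    (Bad : Finset α) {B : ℝ} (hB : 0 ≤ B)
    (hgood : ∀ a, a ∉ Bad → (#(univ.filter fun b => P a b) : ℝ) ≤ B) :
    ∑ a, (#(univ.filter fun b => P a b) : ℝ) ≤ Fintype.card α * B + Fintype.card β * #Bad := by
  classical
  calc ∑ a, (#(univ.filter fun b => P a b) : ℝ)
      ≤ ∑ a, (B + Fintype.card β * (if a ∈ Bad then 1 else 0)) := by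
        refine sum_le_sum fun a _ => ?_
        by_cases ha : a ∈ Bad
        · rw [if_pos ha, mul_one]
          have : (#(univ.filter fun b => P a b) : ℝ) ≤ Fintype.card β := by
            exact_mod_cast (card_le_card (filter_subset _ _)).trans (card_univ (α := β)).le
          linarith
        · rw [if_neg ha, mul_zero, add_zero]; exact hgood a ha
    _ = Fintype.card α * B + Fintype.card β * #Bad := by
        rw [sum_add_distrib, sum_const, card_univ, nsmul_eq_mul, ← mul_sum, Finset.sum_ite_mem, univ_inter,
          sum_const, nsmul_eq_mul, mul_one]

/-- At most `1/η` indices carry relative weight `≥ η`. -/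
lemma card_heavy_le {ι : Type*} [Fintype ι] (K : ι → ℝ) (hK : ∀ i, 0 ≤ K i) {P η : ℝ} (hP : ∑ i, K i ≤ P)
    (hη : 0 < η) (hPpos : 0 < P) :
    (#(univ.filter fun i => η * P ≤ K i) : ℝ) ≤ 1 / η := by
  have h1 : (#(univ.filter fun i => η * P ≤ K i) : ℝ) * (η * P)
      ≤ ∑ i ∈ univ.filter (fun i => η * P ≤ K i), K i := by
    rw [← nsmul_eq_mul, ← sum_const]
    exact sum_le_sum fun i hi => (mem_filter.1 hi).2
  have h2 : ∑ i ∈ univ.filter (fun i => η * P ≤ K i), K i ≤ P :=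
    (sum_le_sum_of_subset_of_nonneg (filter_subset _ _) fun i _ _ => hK i).trans hP
  rw [le_div_iff₀ hη]
  nlinarith [h1.trans h2]

/-- `z · e^{−A z} ≤ 1/A` for `A > 0` (from `1 + y ≤ e^y`). -/
lemma mul_exp_neg_le {A : ℝ} (hA : 0 < A) (z : ℝ) : z * exp (-(A * z)) ≤ 1 / A := by
  rw [exp_neg, ← div_eq_mul_inv, div_le_div_iff₀ (exp_pos _) hA, one_mul]
  nlinarith [add_one_le_exp (A * z)]

/-! ## §2 One block: Hoeffding for a colour-class mass -/

/-- **1D.** For non-negative weights `k` on one block with `Σ k > 0`, peak `≤ kmax`, margin `c > 0` and a colour `β`: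
`#{x¹ : (1/2 + c)Σk < Σ_{a : x¹_a = β} k_a} ≤ 2^t exp(−2c²(Σk)/kmax)`. -/
lemma oneD_card_le (k : Fin t → ℝ) (hk : ∀ a, 0 ≤ k a) {kmax : ℝ} (hkmax : ∀ a, k a ≤ kmax)
    (hK : 0 < ∑ a, k a) {c : ℝ} (hc : 0 < c) (β : Bool) :
    (#(univ.filter fun x1 : Fin t → Bool => (1 / 2 + c) * ∑ a, k a < ∑ a, (if x1 a = β then k a else 0)) : ℝ)
      ≤ 2 ^ t * exp (-(2 * c ^ 2 * (∑ a, k a) / kmax)) := by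
  set K : ℝ := ∑ a, k a with hKdef
  -- the peak is positive
  have hkmax0 : 0 < kmax := by
    have h1 : K ≤ ∑ _a : Fin t, kmax := sum_le_sum fun a _ => hkmax a
    rw [sum_const, card_univ, Fintype.card_fin, nsmul_eq_mul] at h1
    exact pos_of_mul_pos_right (hK.trans_le h1) (Nat.cast_nonneg t)
  -- signed coefficients: `k` for `β = true`, `−k` for `β = false`
  set ks : Fin t → ℝ := fun a => if β then k a else -k a with hksdef
  have hks2 : ∑ a, ks a ^ 2 = ∑ a, k a ^ 2 := by
    refine sum_congr rfl fun a _ => ?_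
    simp only [hksdef]; split_ifs <;> ring
  have hpt : ∀ (x1 : Fin t → Bool) (a : Fin t),
      (if x1 a = β then k a else 0) = (k a + (if x1 a then ks a else -ks a)) / 2 := by
    intro x1 a
    simp only [hksdef]
    cases x1 a <;> cases β <;> simp
  -- the event forces a signed deviation `2cK`
  have hsub : (univ.filter fun x1 : Fin t → Bool => (1 / 2 + c) * K < ∑ a, (if x1 a = β then k a else 0))
      ⊆ univ.filter fun x1 : Fin t → Bool => 2 * c * K ≤ ∑ a, (if x1 a then ks a else -ks a) := by
    intro x1 hx
    rw [mem_filter] at hx ⊢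
    refine ⟨mem_univ _, ?_⟩
    have h := hx.2
    rw [sum_congr rfl fun a _ => hpt x1 a, ← sum_div, sum_add_distrib] at h
    linarith
  have hA : ∑ a, k a ^ 2 ≤ kmax * K := by
    rw [hKdef, mul_sum]
    exact sum_le_sum fun a _ => by rw [sq]; exact mul_le_mul_of_nonneg_right (hkmax a) (hk a)
  have hApos : 0 < ∑ a, k a ^ 2 := by
    by_contra h
    have h0 : ∑ a, k a ^ 2 = 0 := le_antisymm (not_lt.1 h) (sum_nonneg fun a _ => sq_nonneg _)
    have hz : ∀ a, k a = 0 := fun a =>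
      pow_eq_zero_iff (n := 2) (by norm_num) |>.1 ((sum_eq_zero_iff_of_nonneg fun a _ => sq_nonneg (k a)).1 h0 a (mem_univ a))
    have : K = 0 := by rw [hKdef]; exact sum_eq_zero fun a _ => hz a
    linarith
  calc (#(univ.filter fun x1 : Fin t → Bool => (1 / 2 + c) * K < ∑ a, (if x1 a = β then k a else 0)) : ℝ)
      ≤ #(univ.filter fun x1 : Fin t → Bool => 2 * c * K ≤ ∑ a, (if x1 a then ks a else -ks a)) := by
        exact_mod_cast card_le_card hsub
    _ ≤ 2 ^ t * exp (-((2 * c * K) ^ 2 / (2 * ∑ a, ks a ^ 2))) := rademacher_card_le ks (by positivity)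
    _ ≤ 2 ^ t * exp (-(2 * c ^ 2 * K / kmax)) := by
        rw [hks2]
        apply mul_le_mul_of_nonneg_left _ (by positivity)
        rw [exp_le_exp, neg_le_neg_iff, div_le_div_iff₀ hkmax0 (by positivity)]
        have := mul_le_mul_of_nonneg_left hA (by positivity : (0 : ℝ) ≤ 4 * c ^ 2 * K)
        nlinarith [this]


/-! ## §3 Two blocks -/

/-- positivity of the peak from positivity of a double sum below it -/
lemma kmax_pos_of_sum₂ {pl : Fin t → Fin t → ℝ} {kmax : ℝ} (hkmax : ∀ a b, pl a b ≤ kmax)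
    (hP : 0 < ∑ a, ∑ b, pl a b) : 0 < kmax := by
  have h1 : ∑ a, ∑ b, pl a b ≤ ∑ _a : Fin t, ∑ _b : Fin t, kmax :=
    sum_le_sum fun a _ => sum_le_sum fun b _ => hkmax a b
  rw [sum_const, sum_const, card_univ, Fintype.card_fin, smul_smul, nsmul_eq_mul] at h1
  exact pos_of_mul_pos_right (hP.trans_le h1) (Nat.cast_nonneg _)

/-- **2D.** For non-negative weights `pl` on two blocks (`P = Σ pl > 0`, peak `≤ kmax`), margin `c > 0`, heavy
threshold `η' > 0` and a colour `β`:
`#{(x¹,x²) : (1/2 + c)P < pl(C¹_β × C²_β)} ≤ 4^t e^{−9c²/(8η')} + (2^t/η')·2^t e^{−2(c/4)² η' P/kmax}`. -/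
lemma twoD_card_le (pl : Fin t → Fin t → ℝ) (hpl : ∀ a b, 0 ≤ pl a b) {kmax : ℝ} (hkmax : ∀ a b, pl a b ≤ kmax)
    (hP : 0 < ∑ a, ∑ b, pl a b) {c η' : ℝ} (hc : 0 < c) (hη' : 0 < η') (β : Bool) :
    (#(univ.filter fun x12 : (Fin t → Bool) × (Fin t → Bool) =>
        (1 / 2 + c) * ∑ a, ∑ b, pl a b < ∑ a, ∑ b, (if x12.1 a = β ∧ x12.2 b = β then pl a b else 0)) : ℝ)
      ≤ 4 ^ t * exp (-(9 * c ^ 2 / (8 * η')))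
        + 2 ^ t * (1 / η') * (2 ^ t * exp (-(2 * (c / 4) ^ 2 * (η' * ∑ a, ∑ b, pl a b) / kmax))) := by
  have hkmax0 : 0 < kmax := kmax_pos_of_sum₂ hkmax hP
  set P : ℝ := ∑ a, ∑ b, pl a b with hPdef
  -- column masses `K b` and colour-class column masses `C x1 b`
  have hK0 : ∀ b, 0 ≤ ∑ a, pl a b := fun b => sum_nonneg fun a _ => hpl a b
  have hKsum : ∑ b, ∑ a, pl a b = P := by rw [hPdef, sum_comm]
  have hC0 : ∀ (x1 : Fin t → Bool) b, 0 ≤ ∑ a, (if x1 a = β then pl a b else 0) :=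
    fun x1 b => sum_nonneg fun a _ => by split_ifs <;> [exact hpl a b; exact le_rfl]
  have hCK : ∀ (x1 : Fin t → Bool) b, ∑ a, (if x1 a = β then pl a b else 0) ≤ ∑ a, pl a b :=
    fun x1 b => sum_le_sum fun a _ => by split_ifs <;> [exact le_rfl; exact hpl a b]
  -- the quarter mass, column by column
  have hquarter : ∀ (x1 x2 : Fin t → Bool),
      ∑ a, ∑ b, (if x1 a = β ∧ x2 b = β then pl a b else 0)
        = ∑ b, (if x2 b = β then ∑ a, (if x1 a = β then pl a b else 0) else 0) := by
    intro x1 x2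
    rw [sum_comm]
    refine sum_congr rfl fun b _ => ?_
    by_cases hb : x2 b = β
    · rw [if_pos hb]; exact sum_congr rfl fun a _ => by simp [hb]
    · rw [if_neg hb]; exact sum_eq_zero fun a _ => by simp [hb]
  -- heavy columns, exceptional colourings of block 1, bad colourings
  set H' : Finset (Fin t) := univ.filter fun b => η' * P ≤ ∑ a, pl a b with hH'def
  set F : Fin t → Finset (Fin t → Bool) := fun b =>
    univ.filter fun x1 => (1 / 2 + c / 4) * ∑ a, pl a b < ∑ a, (if x1 a = β then pl a b else 0) with hFdef
  set Bad : Finset (Fin t → Bool) := H'.biUnion F with hBaddef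
  have hH'card : (#H' : ℝ) ≤ 1 / η' := card_heavy_le (fun b => ∑ a, pl a b) hK0 hKsum.le hη' hP
  -- good colourings of block 1: the peeling lemma along block 2
  have hgood : ∀ x1 : Fin t → Bool, x1 ∉ Bad →
      (#(univ.filter fun x2 : Fin t → Bool =>
          (1 / 2 + c) * P < ∑ a, ∑ b, (if (x1, x2).1 a = β ∧ (x1, x2).2 b = β then pl a b else 0)) : ℝ)
        ≤ 2 ^ t * exp (-(9 * c ^ 2 / (8 * η'))) := by
    intro x1 hx1
    have hPEEL := peel_card_le (t := t)
      (fun b => if β then 0 else (∑ a, (if x1 a = β then pl a b else 0)) / P)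
      (fun b => if β then (∑ a, (if x1 a = β then pl a b else 0)) / P else 0)
      (fun b => (∑ a, pl a b) / P)
      (fun b => by
        show 0 ≤ (if β then 0 else (∑ a, (if x1 a = β then pl a b else 0)) / P)
        split_ifs <;> [exact le_rfl; exact div_nonneg (hC0 x1 b) hP.le])
      (fun b => by
        show 0 ≤ (if β then (∑ a, (if x1 a = β then pl a b else 0)) / P else 0)
        split_ifs <;> [exact div_nonneg (hC0 x1 b) hP.le; exact le_rfl])
      (fun b => by
        show (if β then 0 else (∑ a, (if x1 a = β then pl a b else 0)) / P)
            + (if β then (∑ a, (if x1 a = β then pl a b else 0)) / P else 0) ≤ (∑ a, pl a b) / P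
        have := div_le_div_of_nonneg_right (hCK x1 b) hP.le
        cases β <;> simpa using this)
      (by
        show ∑ b, (∑ a, pl a b) / P ≤ 1
        rw [← sum_div, hKsum, div_self hP.ne'])
      hc hη'
      (fun b hb => by
        -- a heavy column of a good colouring is not exceptional
        have hb' : η' * P ≤ ∑ a, pl a b := by
          have := hb; rwa [le_div_iff₀ hP] at this
        have hbH : b ∈ H' := by rw [hH'def, mem_filter]; exact ⟨mem_univ _, hb'⟩
        have hnot : x1 ∉ F b := fun hx => hx1 (by rw [hBaddef, mem_biUnion]; exact ⟨b, hbH, hx⟩)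
        have hle : ∑ a, (if x1 a = β then pl a b else 0) ≤ (1 / 2 + c / 4) * ∑ a, pl a b := by
          have : ¬ ((1 / 2 + c / 4) * ∑ a, pl a b < ∑ a, (if x1 a = β then pl a b else 0)) := fun hlt =>
            hnot (by rw [hFdef]; exact mem_filter.2 ⟨mem_univ _, hlt⟩)
          exact not_lt.1 this
        have hmax : max (if β then 0 else (∑ a, (if x1 a = β then pl a b else 0)) / P)
            (if β then (∑ a, (if x1 a = β then pl a b else 0)) / P else 0)
            = (∑ a, (if x1 a = β then pl a b else 0)) / P := by
          cases β <;> simp [div_nonneg (hC0 x1 b) hP.le]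
        show max _ _ ≤ (1 / 2 + c / 4) * ((∑ a, pl a b) / P)
        rw [hmax, mul_div_assoc']
        exact div_le_div_of_nonneg_right hle hP.le)
    refine le_trans ?_ hPEEL
    refine Nat.cast_le.2 (card_le_card fun x2 hx2 => ?_)
    rw [mem_filter] at hx2 ⊢
    refine ⟨mem_univ _, ?_⟩
    have h := hx2.2
    rw [hquarter x1 x2] at h
    have hW : ∑ d, (if x2 d then (if β then (∑ a, (if x1 a = β then pl a d else 0)) / P else 0)
          else (if β then 0 else (∑ a, (if x1 a = β then pl a d else 0)) / P))
        = (∑ b, (if x2 b = β then ∑ a, (if x1 a = β then pl a b else 0) else 0)) / P := by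
      rw [sum_div]
      refine sum_congr rfl fun d _ => ?_
      cases x2 d <;> cases β <;> simp
    show 1 / 2 + c ≤ ∑ d, (if x2 d then (if β then (∑ a, (if x1 a = β then pl a d else 0)) / P else 0)
          else (if β then 0 else (∑ a, (if x1 a = β then pl a d else 0)) / P))
    rw [hW, le_div_iff₀ hP]
    exact h.le
  -- bad colourings of block 1: few heavy columns, each rarely exceptional (1D)
  have hBad : (#Bad : ℝ) ≤ (1 / η') * (2 ^ t * exp (-(2 * (c / 4) ^ 2 * (η' * P) / kmax))) := by
    have h1 : (#Bad : ℝ) ≤ ∑ b ∈ H', (#(F b) : ℝ) := by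
      rw [hBaddef]; exact_mod_cast card_biUnion_le
    have h2 : ∀ b ∈ H', (#(F b) : ℝ) ≤ 2 ^ t * exp (-(2 * (c / 4) ^ 2 * (η' * P) / kmax)) := by
      intro b hb
      have hKb : η' * P ≤ ∑ a, pl a b := (mem_filter.1 hb).2
      have hKpos : 0 < ∑ a, pl a b := lt_of_lt_of_le (by positivity) hKb
      have h1D := oneD_card_le (fun a => pl a b) (fun a => hpl a b) (fun a => hkmax a b) hKpos
        (by positivity : 0 < c / 4) β
      refine le_trans (by simpa [hFdef] using h1D) ?_
      apply mul_le_mul_of_nonneg_left _ (by positivity)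
      rw [exp_le_exp, neg_le_neg_iff]
      refine div_le_div_of_nonneg_right ?_ hkmax0.le
      exact mul_le_mul_of_nonneg_left hKb (by positivity)
    calc (#Bad : ℝ) ≤ ∑ b ∈ H', (#(F b) : ℝ) := h1
      _ ≤ ∑ b ∈ H', 2 ^ t * exp (-(2 * (c / 4) ^ 2 * (η' * P) / kmax)) := sum_le_sum h2
      _ = #H' * (2 ^ t * exp (-(2 * (c / 4) ^ 2 * (η' * P) / kmax))) := by rw [sum_const, nsmul_eq_mul]
      _ ≤ (1 / η') * (2 ^ t * exp (-(2 * (c / 4) ^ 2 * (η' * P) / kmax))) :=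
          mul_le_mul_of_nonneg_right hH'card (by positivity)
  -- count over block 1 first, then split into good and bad
  rw [card_filter_prod_eq]
  push_cast
  have hsplit := sum_card_le_split
    (fun (x1 x2 : Fin t → Bool) =>
      (1 / 2 + c) * P < ∑ a, ∑ b, (if (x1, x2).1 a = β ∧ (x1, x2).2 b = β then pl a b else 0))
    Bad (by positivity) hgood
  simp only [Fintype.card_fun, Fintype.card_bool, Fintype.card_fin, Nat.cast_pow, Nat.cast_ofNat] at hsplit
  have h4 : (4 : ℝ) ^ t = 2 ^ t * 2 ^ t := by rw [← mul_pow]; norm_num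
  calc (∑ x1 : Fin t → Bool, (#(univ.filter fun x2 : Fin t → Bool =>
          (1 / 2 + c) * P < ∑ a, ∑ b, (if (x1, x2).1 a = β ∧ (x1, x2).2 b = β then pl a b else 0)) : ℝ))
      ≤ 2 ^ t * (2 ^ t * exp (-(9 * c ^ 2 / (8 * η')))) + 2 ^ t * #Bad := by
        simpa [Nat.cast_sum] using hsplit
    _ ≤ 4 ^ t * exp (-(9 * c ^ 2 / (8 * η')))
        + 2 ^ t * (1 / η') * (2 ^ t * exp (-(2 * (c / 4) ^ 2 * (η' * P) / kmax))) := by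
        rw [h4, mul_assoc, mul_assoc (2 ^ t : ℝ)]
        gcongr

/-- **Level two of Lemma Ψ** (registered sub-goal `twoD_count_bound` of stmt-PneNP-10680, explicit form of
`twoD_card_le`). -/
theorem twoD_count_bound :
    ∀ (t : ℕ) (pl : Fin t → Fin t → ℝ), (∀ a b, 0 ≤ pl a b) → ∀ (kmax : ℝ), (∀ a b, pl a b ≤ kmax) →
    0 < ∑ a, ∑ b, pl a b → ∀ (c η' : ℝ), 0 < c → 0 < η' → ∀ (β : Bool),
    ((Finset.univ.filter fun x12 : (Fin t → Bool) × (Fin t → Bool) =>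
        (1 / 2 + c) * ∑ a, ∑ b, pl a b < ∑ a, ∑ b, (if x12.1 a = β ∧ x12.2 b = β then pl a b else 0)).card : ℝ)
      ≤ 4 ^ t * Real.exp (-(9 * c ^ 2 / (8 * η')))
        + 2 ^ t * (1 / η') * (2 ^ t * Real.exp (-(2 * (c / 4) ^ 2 * (η' * ∑ a, ∑ b, pl a b) / kmax))) :=
  fun _ pl hpl _ hkmax hP _ _ hc hη' β => twoD_card_le pl hpl hkmax hP hc hη' β

end

end Summit.PneNP.PneNP.Theorems.XorDoor.TriLine
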